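import Mathlib.RingTheory.AdjoinRoot
import Mathlib.Algebra.BigOperators.Fin
import Mathlib.Algebra.Polynomial.Degree.Lemmas
import HarnessLib

/-!
# The Cantor–Kaltofen negacyclic transform over a ring: butterflies as residues, evaluation, inversion, products

Literature / complexity toolkit (pure algebra; no machines), third layer of the
polynomial-arithmetic programme serving the machine of Harvey's deterministic factoring
algorithm (`Cryptography/PQCWave0.lean`, fact `harvey_factoring_one_fifth`; machines in
`StackZnVectors.lean`, `StackNegacyclic.lean`).  It proves, over an arbitrary commutative ring
`S` with an element `ψ` such that `ψ^{2m} = -1` and with `2` invertible, the correctness of the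
radix-2 transform in `S[y]/(y^t - ψ^{2m})` in the **CRT / butterfly-as-residue form** that the
stack machine executes level by level on LISTS of blocks (no bit reversal, no weights, no
final scaling by `t⁻¹`: every node of the recursion tree carries a twiddle EXPONENT `F`, its
modulus being `y^{2^lv} - ψ^F`, and splits into the children `F/2` and `F/2 + 2m`):

* `ev ω A = Σ A_i ω^i` (Horner form; `ev_append`, `ev_eq_sum`) and the key observation
  **`ev_append_eq_ev_butterfly`**: if `ω^h = c`, evaluating `U ++ W` at `ω` is evaluating the
  butterfly output `U + c·W` at `ω` (the butterfly computes residues);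
* `bfly`, `fwd ψ m F lv` (the forward transform), `leafExps m F lv` (the exponents at the
  leaves), `pow_leafExps` (the leaves are roots: `(ψ^G)^{2^lv} = ψ^F` when `2^lv ∣ F`,
  `2^lv ∣ 4m`) and **`fwd_eq_map_ev`**: the forward transform is the list of the values
  `ev (ψ^G) L` over the leaves;
* `tconv c t A B` — the twisted convolution in `S[y]/(y^t - c)` — and **`ev_tconv`**:
  evaluation at a root of `y^t - c` is multiplicative on it;
* `ibfly`, `inv` (the inverse transform: `(u+v)/2`, `ψ^{4m-E}(u-v)/2`) and **`inv_fwd`**: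
  `inv F lv (fwd F lv L) = L` (`F < 4m`);
* **`inv_mul_fwd`**: `inv (fwd A ⊙ fwd B) = tconv (ψ^F) t A B` — at the root `F = 2m`,
  `ψ^F = -1`, the negacyclic product (`getD_tconv_neg_one`).

Relation to `AlgebraicComplexity/FastFourierTransform.lean`, `…/SchonhageStrassen*.lean`
(landed the same day): those formalise GG Algorithm 8.20 in its DFT form (weights, `fft`,
bit reversal, scaling) on coefficient functions `ℕ → R`; the present file is the
Cantor–Kaltofen reformulation on lists, chosen because each of its levels is one uniform
streaming pass of the stack machine (`NegacyclicFFT.lean` instantiates it on residue blocks).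

## References

* D. G. Cantor, E. Kaltofen, *On fast multiplication of polynomials over arbitrary algebras*,
  Acta Inform. 28 (1991) 693–701 (the transform over rings with a principal root of unity, in
  the residue form). (Not held; the content used is proved here.)
* J. von zur Gathen, J. Gerhard, *Modern Computer Algebra*, 3rd ed., CUP 2013, §8.2 (FFT =
  evaluation at the roots; Fig. 8.4 the butterfly), §8.3 Alg. 8.20 / Thm. 8.22–8.23
  (Schönhage–Strassen's negative wrapped convolution). (Folklore material, fully proved here.)
* A. Schönhage, V. Strassen, *Schnelle Multiplikation großer Zahlen*, Computing 7 (1971)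
  281–292.
-/

namespace Literature.Computability.Complexity

namespace NegFFT

open Finset

variable {S : Type*} [CommRing S]

/-! ### Evaluation of a coefficient list -/

/-- `ev ω A = Σ_i A_i ω^i` (Horner form). [folklore] -/
def ev (ω : S) : List S → S
  | [] => 0
  | a :: A => a + ω * ev ω A

/-- `ev` of the empty list. [folklore] -/
@[simp] theorem ev_nil (ω : S) : ev ω [] = 0 := rfl

/-- `ev` of a nonempty list. [folklore] -/
@[simp] theorem ev_cons (ω a : S) (A : List S) : ev ω (a :: A) = a + ω * ev ω A := rfl

/-- `ev` of a concatenation. [folklore] -/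
theorem ev_append (ω : S) (A B : List S) : ev ω (A ++ B) = ev ω A + ω ^ A.length * ev ω B := by
  induction A with
  | nil => simp
  | cons a A ih => rw [List.cons_append, ev_cons, ih, ev_cons, List.length_cons, pow_succ]; ring

/-- `ev` is additive on lists of equal length, with a scalar: `ev (zipWith (u + c w)) = ev U + c ev W`.
[folklore] -/
theorem ev_zipWith_add_mul (ω c : S) : ∀ (U W : List S), U.length = W.length →
    ev ω (List.zipWith (fun u w => u + c * w) U W) = ev ω U + c * ev ω W
  | [], [], _ => by simp
  | [], _ :: _, h => by simp at h
  | _ :: _, [], h => by simp at h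
  | u :: U, w :: W, h => by
    rw [List.zipWith_cons_cons, ev_cons, ev_zipWith_add_mul ω c U W (by simpa using h), ev_cons, ev_cons]; ring

/-- **The butterfly is the residue map**: if `ω^h = c` then evaluating the segment `U ++ W`
(`|U| = |W| = h`, i.e. the polynomial `U + y^h W`) at `ω` is evaluating `U + c·W` at `ω`.
[von zur Gathen–Gerhard 2013, §8.2–8.3] [folklore] -/
theorem ev_append_eq_ev_butterfly (ω c : S) {U W : List S} (h : U.length = W.length) (hω : ω ^ U.length = c) :
    ev ω (U ++ W) = ev ω (List.zipWith (fun u w => u + c * w) U W) := by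
  rw [ev_append, hω, ev_zipWith_add_mul ω c U W h]

/-- `ev` as a finite sum. [folklore] -/
theorem ev_eq_sum (ω : S) (A : List S) : ev ω A = ∑ i ∈ range A.length, A.getD i 0 * ω ^ i := by
  induction A with
  | nil => simp
  | cons a A ih =>
    rw [ev_cons, ih, List.length_cons, Finset.sum_range_succ', pow_zero, mul_one]
    simp only [List.getD_cons_succ, List.getD_cons_zero, pow_succ]
    rw [add_comm, Finset.mul_sum]
    congr 1
    exact Finset.sum_congr rfl fun i _ => by ring

/-! ### The forward transform: twiddle exponents, leaves, evaluation -/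

variable (ψ : S) (m : ℕ)

/-- One butterfly with twiddle `ψ^E` on a segment: halves `U`, `W` ↦ `(U + ψ^E W) ++ (U - ψ^E W)`.
[folklore] -/
def bfly (E : ℕ) (L : List S) : List S :=
  List.zipWith (fun u w => u + ψ ^ E * w) (L.take (L.length / 2)) (L.drop (L.length / 2)) ++
    List.zipWith (fun u w => u - ψ ^ E * w) (L.take (L.length / 2)) (L.drop (L.length / 2))

/-- The forward transform below a node with twiddle exponent `F` (modulus `y^{2^lv} - ψ^F`),
`lv` levels deep: split by the butterfly with `ψ^{F/2}` and recurse with exponents `F/2` and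
`F/2 + 2m`. [von zur Gathen–Gerhard 2013, Alg. 8.20; Cantor–Kaltofen 1991] [folklore] -/
def fwd : ℕ → ℕ → List S → List S
  | _, 0, L => L
  | F, lv + 1, L =>
    fwd (F / 2) lv ((bfly ψ (F / 2) L).take (L.length / 2)) ++
      fwd (F / 2 + 2 * m) lv ((bfly ψ (F / 2) L).drop (L.length / 2))

/-- The exponents at the leaves below a node `(F, lv)`, left to right. [folklore] -/
def leafExps : ℕ → ℕ → List ℕ
  | F, 0 => [F]
  | F, lv + 1 => leafExps (F / 2) lv ++ leafExps (F / 2 + 2 * m) lv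

/-- There are `2^lv` leaves. [folklore] -/
@[simp] theorem length_leafExps : ∀ (F lv : ℕ), (leafExps m F lv).length = 2 ^ lv
  | F, 0 => rfl
  | F, lv + 1 => by rw [leafExps, List.length_append, length_leafExps, length_leafExps, pow_succ]; ring

/-- Leaf exponents stay below `4m` when the root's does and `2m > 0`... precisely: if `F < 4m` then
every leaf exponent is `< 4m`. [folklore] -/
theorem leafExps_lt : ∀ {F lv : ℕ}, F < 4 * m → ∀ G ∈ leafExps m F lv, G < 4 * m
  | F, 0, hF, G, hG => by simp [leafExps] at hG; omega
  | F, lv + 1, hF, G, hG => by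
    simp only [leafExps, List.mem_append] at hG
    rcases hG with hG | hG
    · exact leafExps_lt (by omega) G hG
    · exact leafExps_lt (by omega) G hG

variable {ψ m}

/-- Halving an exponent divisible by `2^(lv+1)`. [folklore] -/
theorem div_two_facts {F lv : ℕ} (hF : 2 ^ (lv + 1) ∣ F) : F / 2 * 2 = F ∧ 2 ^ lv ∣ F / 2 := by
  obtain ⟨c, rfl⟩ := hF
  refine ⟨Nat.div_mul_cancel ((dvd_pow_self 2 (Nat.succ_ne_zero lv)).mul_right c), ?_⟩
  rw [show 2 ^ (lv + 1) * c = 2 * (2 ^ lv * c) by ring, Nat.mul_div_cancel_left _ two_pos]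
  exact Dvd.intro c rfl

/-- From `2^(lv+1) ∣ 4m` to `2^lv ∣ 2m`. [folklore] -/
theorem dvd_two_mul_of {lv m : ℕ} (hm : 2 ^ (lv + 1) ∣ 4 * m) : 2 ^ lv ∣ 2 * m := by
  rw [pow_succ', show 4 * m = 2 * (2 * m) by ring] at hm
  exact Nat.dvd_of_mul_dvd_mul_left (by norm_num) hm

/-- **The leaves are roots**: if `ψ^{2m} = -1`, `2^lv ∣ F` and `2^lv ∣ 4m`, then every leaf
exponent `G` below `(F, lv)` satisfies `(ψ^G)^{2^lv} = ψ^F`. [folklore] -/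
theorem pow_leafExps (hψ : ψ ^ (2 * m) = -1) :
    ∀ {F lv : ℕ}, 2 ^ lv ∣ F → 2 ^ lv ∣ 4 * m → ∀ G ∈ leafExps m F lv, (ψ ^ G) ^ (2 ^ lv) = ψ ^ F
  | F, 0, _, _, G, hG => by simp [leafExps] at hG; simp [hG]
  | F, lv + 1, hF, hm, G, hG => by
    obtain ⟨hF2, hdvd⟩ := div_two_facts hF
    have hm' : 2 ^ lv ∣ 2 * m := dvd_two_mul_of hm
    have hm'' : 2 ^ lv ∣ 4 * m := (pow_dvd_pow 2 (Nat.le_succ lv)).trans hm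
    simp only [leafExps, List.mem_append] at hG
    rcases hG with hG | hG
    · have := pow_leafExps hψ hdvd hm'' G hG
      rw [pow_succ, pow_mul, this, ← pow_mul, hF2]
    · have := pow_leafExps hψ (Nat.dvd_add hdvd hm') hm'' G hG
      rw [pow_succ, pow_mul, this, ← pow_mul, Nat.add_mul, hF2, pow_add, show 2 * m * 2 = 2 * m + 2 * m by ring,
        pow_add, hψ]
      ring

/-- The butterfly halves have half the length. [folklore] -/
theorem length_bfly_take (E : ℕ) {L : List S} {h : ℕ} (hL : L.length = 2 * h) :
    ((bfly ψ E L).take (L.length / 2)).length = h ∧ ((bfly ψ E L).drop (L.length / 2)).length = h ∧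
    (bfly ψ E L).take (L.length / 2) = List.zipWith (fun u w => u + ψ ^ E * w) (L.take h) (L.drop h) ∧
    (bfly ψ E L).drop (L.length / 2) = List.zipWith (fun u w => u - ψ ^ E * w) (L.take h) (L.drop h) := by
  have hh : L.length / 2 = h := by rw [hL]; omega
  have hl1 : (List.zipWith (fun u w => u + ψ ^ E * w) (L.take h) (L.drop h)).length = h := by
    rw [List.length_zipWith, List.length_take, List.length_drop, hL]; omega
  have hl2 : (List.zipWith (fun u w => u - ψ ^ E * w) (L.take h) (L.drop h)).length = h := by
    rw [List.length_zipWith, List.length_take, List.length_drop, hL]; omega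
  unfold bfly
  rw [hh]
  refine ⟨?_, ?_, ?_, ?_⟩
  · rw [List.take_append_of_le_length (by rw [hl1]), List.length_take, hl1, min_self]
  · rw [List.drop_append_of_le_length (by rw [hl1]), List.length_append, List.length_drop, hl1, hl2]; simp
  · rw [List.take_append_of_le_length (by rw [hl1]), List.take_of_length_le (by rw [hl1])]
  · rw [List.drop_append_of_le_length (by rw [hl1]), List.drop_of_length_le (by rw [hl1]), List.nil_append]

/-- The transform preserves the length. [folklore] -/
theorem length_fwd : ∀ (F lv : ℕ) {L : List S}, L.length = 2 ^ lv → (fwd ψ m F lv L).length = 2 ^ lv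
  | F, 0, L, hL => hL
  | F, lv + 1, L, hL => by
    obtain ⟨h1, h2, -, -⟩ := length_bfly_take (ψ := ψ) (F / 2) (h := 2 ^ lv) (L := L) (by rw [hL, pow_succ]; ring)
    rw [fwd, List.length_append, length_fwd _ lv h1, length_fwd _ lv h2, pow_succ]; ring

/-- **The forward transform evaluates at the leaves**: if `ψ^{2m} = -1`, `2^lv ∣ F`, `2^lv ∣ 4m`
and `|L| = 2^lv`, then `fwd F lv L` is the list of the values `ev (ψ^G) L` over the leaf
exponents `G` below `(F, lv)`. [von zur Gathen–Gerhard 2013, §8.2 (FFT = multipoint evaluation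
at the roots); Cantor–Kaltofen 1991] [folklore] -/
theorem fwd_eq_map_ev (hψ : ψ ^ (2 * m) = -1) :
    ∀ {F lv : ℕ} {L : List S}, 2 ^ lv ∣ F → 2 ^ lv ∣ 4 * m → L.length = 2 ^ lv →
      fwd ψ m F lv L = (leafExps m F lv).map fun G => ev (ψ ^ G) L
  | F, 0, L, _, _, hL => by
    cases L with
    | nil => simp at hL
    | cons a L =>
      simp only [List.length_cons, pow_zero, Nat.add_eq_right, List.length_eq_zero_iff] at hL
      subst hL; simp [fwd, leafExps]
  | F, lv + 1, L, hF, hm, hL => by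
    obtain ⟨hF2, hdvd⟩ := div_two_facts hF
    have hm' : 2 ^ lv ∣ 2 * m := dvd_two_mul_of hm
    have hm'' : 2 ^ lv ∣ 4 * m := (pow_dvd_pow 2 (Nat.le_succ lv)).trans hm
    have hL2 : L.length = 2 * 2 ^ lv := by rw [hL, pow_succ]; ring
    obtain ⟨h1, h2, e1, e2⟩ := length_bfly_take (ψ := ψ) (F / 2) (h := 2 ^ lv) (L := L) hL2
    have htk : (L.take (2 ^ lv)).length = 2 ^ lv := by rw [List.length_take, hL2]; omega
    have hdr : (L.drop (2 ^ lv)).length = 2 ^ lv := by rw [List.length_drop, hL2]; omega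
    rw [fwd, fwd_eq_map_ev hψ hdvd hm'' h1, fwd_eq_map_ev hψ (Nat.dvd_add hdvd hm') hm'' h2, leafExps,
      List.map_append]
    congr 1
    · refine List.map_congr_left fun G hG => ?_
      rw [e1]
      conv_rhs => rw [← List.take_append_drop (2 ^ lv) L]
      exact (ev_append_eq_ev_butterfly _ _ (htk.trans hdr.symm) (by rw [htk]; exact pow_leafExps hψ hdvd hm'' G hG)).symm
    · refine List.map_congr_left fun G hG => ?_
      rw [e2]
      conv_rhs => rw [← List.take_append_drop (2 ^ lv) L]
      have hroot : (ψ ^ G) ^ (L.take (2 ^ lv)).length = -ψ ^ (F / 2) := by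
        rw [htk, pow_leafExps hψ (Nat.dvd_add hdvd hm') hm'' G hG, pow_add, hψ]; ring
      rw [ev_append_eq_ev_butterfly _ _ (htk.trans hdr.symm) hroot]
      simp only [neg_mul, sub_eq_add_neg]

/-! ### Products: the twisted convolution and its evaluations -/

/-- The twisted convolution of two coefficient lists of length `t` in `S[y]/(y^t - c)`:
`C_σ = Σ_{i+l=σ} A_i B_l + c · Σ_{i+l=σ+t} A_i B_l`. [folklore] -/
def tconv (c : S) (t : ℕ) (A B : List S) : List S :=
  (List.range t).map fun σ => ∑ i ∈ range t, ∑ l ∈ range t,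
    ((if i + l = σ then A.getD i 0 * B.getD l 0 else 0) + (if i + l = σ + t then c * (A.getD i 0 * B.getD l 0) else 0))

/-- The twisted convolution has length `t`. [folklore] -/
@[simp] theorem length_tconv (c : S) (t : ℕ) (A B : List S) : (tconv c t A B).length = t := by
  simp [tconv]

/-- Entries of the twisted convolution. [folklore] -/
theorem getD_tconv (c : S) (t : ℕ) (A B : List S) {σ : ℕ} (hσ : σ < t) :
    (tconv c t A B).getD σ 0 = ∑ i ∈ range t, ∑ l ∈ range t,
      ((if i + l = σ then A.getD i 0 * B.getD l 0 else 0) + (if i + l = σ + t then c * (A.getD i 0 * B.getD l 0) else 0)) := by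
  unfold tconv
  simp [List.getD_eq_getElem?_getD, List.getElem?_range hσ]

/-- **Evaluation is multiplicative on the twisted convolution**: at a root `ω` of `y^t - c`,
`ev ω (tconv c t A B) = ev ω A · ev ω B` (`|A| = |B| = t`). [von zur Gathen–Gerhard 2013, §8.2]
[folklore] -/
theorem ev_tconv (ω c : S) {t : ℕ} (hω : ω ^ t = c) {A B : List S} (hA : A.length = t) (hB : B.length = t) :
    ev ω (tconv c t A B) = ev ω A * ev ω B := by
  rw [ev_eq_sum, ev_eq_sum, ev_eq_sum, hA, hB, length_tconv, Finset.sum_mul_sum]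
  -- expand the entries
  have step1 : ∑ σ ∈ range t, (tconv c t A B).getD σ 0 * ω ^ σ =
      ∑ σ ∈ range t, ∑ i ∈ range t, ∑ l ∈ range t,
        ((if i + l = σ then A.getD i 0 * B.getD l 0 * ω ^ σ else 0) +
          (if i + l = σ + t then c * (A.getD i 0 * B.getD l 0) * ω ^ σ else 0)) := by
    refine Finset.sum_congr rfl fun σ hσ => ?_
    rw [getD_tconv c t A B (by simpa using hσ), Finset.sum_mul]
    refine Finset.sum_congr rfl fun i _ => ?_
    rw [Finset.sum_mul]
    refine Finset.sum_congr rfl fun l _ => ?_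
    split_ifs <;> ring
  rw [step1, Finset.sum_comm]
  refine Finset.sum_congr rfl fun i hi => ?_
  rw [Finset.sum_comm]
  refine Finset.sum_congr rfl fun l hl => ?_
  simp only [Finset.mem_range] at hi hl
  rw [Finset.sum_add_distrib]
  -- the two indicator sums pick one index each
  have e1 : ∑ σ ∈ range t, (if i + l = σ then A.getD i 0 * B.getD l 0 * ω ^ σ else 0) =
      if i + l < t then A.getD i 0 * B.getD l 0 * ω ^ (i + l) else 0 := by
    rw [Finset.sum_ite_eq (range t) (i + l) (fun σ => A.getD i 0 * B.getD l 0 * ω ^ σ)]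
    simp
  have e2 : ∑ σ ∈ range t, (if i + l = σ + t then c * (A.getD i 0 * B.getD l 0) * ω ^ σ else 0) =
      if t ≤ i + l then c * (A.getD i 0 * B.getD l 0) * ω ^ (i + l - t) else 0 := by
    by_cases h : t ≤ i + l
    · rw [if_pos h]
      have : ∀ σ ∈ range t, (if i + l = σ + t then c * (A.getD i 0 * B.getD l 0) * ω ^ σ else 0) =
          (if i + l - t = σ then c * (A.getD i 0 * B.getD l 0) * ω ^ σ else 0) := by
        intro σ _
        by_cases h' : i + l = σ + t
        · rw [if_pos h', if_pos (by omega)]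
        · rw [if_neg h', if_neg (by omega)]
      rw [Finset.sum_congr rfl this, Finset.sum_ite_eq (range t) (i + l - t)]
      rw [if_pos (by simp; omega)]
    · rw [if_neg h]
      refine Finset.sum_eq_zero fun σ _ => ?_
      rw [if_neg (by omega)]
  rw [e1, e2]
  by_cases h : i + l < t
  · rw [if_pos h, if_neg (by omega), add_zero, pow_add]; ring
  · rw [if_neg h, if_pos (by omega), zero_add, ← hω,
      show ω ^ t * (A.getD i 0 * B.getD l 0) * ω ^ (i + l - t) = A.getD i 0 * B.getD l 0 * (ω ^ t * ω ^ (i + l - t)) by ring,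
      ← pow_add, show t + (i + l - t) = i + l by omega, pow_add]
    ring

/-! ### The inverse transform -/

/-- The inverse butterfly with twiddle exponent `E`: halves `A`, `B` ↦
`(A + B)/2 ++ ψ^{4m-E} (A - B)/2`. [folklore] -/
def ibfly (ψ : S) (m : ℕ) (inv2 : S) (E : ℕ) (M : List S) : List S :=
  List.zipWith (fun a b => inv2 * (a + b)) (M.take (M.length / 2)) (M.drop (M.length / 2)) ++
    List.zipWith (fun a b => ψ ^ (4 * m - E) * (inv2 * (a - b))) (M.take (M.length / 2)) (M.drop (M.length / 2))

/-- The inverse transform below a node `(F, lv)`: invert the two children, then the inverse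
butterfly with `ψ^{F/2}`. [von zur Gathen–Gerhard 2013, Alg. 8.20; Cantor–Kaltofen 1991]
[folklore] -/
def inv (ψ : S) (m : ℕ) (inv2 : S) : ℕ → ℕ → List S → List S
  | _, 0, M => M
  | F, lv + 1, M =>
    ibfly ψ m inv2 (F / 2) (inv ψ m inv2 (F / 2) lv (M.take (M.length / 2)) ++ inv ψ m inv2 (F / 2 + 2 * m) lv (M.drop (M.length / 2)))

omit [CommRing S] in
/-- Zipping two zips of the same lists. [folklore] -/
theorem zipWith_zipWith_same (f : S → S → S) (g g' : S → S → S) :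
    ∀ (U W : List S), List.zipWith f (List.zipWith g U W) (List.zipWith g' U W) =
      List.zipWith (fun u w => f (g u w) (g' u w)) U W
  | [], _ => by simp
  | _ :: _, [] => by simp
  | u :: U, w :: W => by simp [List.zipWith_cons_cons, zipWith_zipWith_same f g g' U W]

omit [CommRing S] in
/-- Zipping with the first projection. [folklore] -/
theorem zipWith_fst : ∀ (U W : List S), U.length = W.length → List.zipWith (fun u _ => u) U W = U
  | [], [], _ => rfl
  | [], _ :: _, h => by simp at h
  | _ :: _, [], h => by simp at h
  | u :: U, w :: W, h => by rw [List.zipWith_cons_cons, zipWith_fst U W (by simpa using h)]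

omit [CommRing S] in
/-- Zipping with the second projection. [folklore] -/
theorem zipWith_snd : ∀ (U W : List S), U.length = W.length → List.zipWith (fun _ w => w) U W = W
  | [], [], _ => rfl
  | [], _ :: _, h => by simp at h
  | _ :: _, [], h => by simp at h
  | u :: U, w :: W, h => by rw [List.zipWith_cons_cons, zipWith_snd U W (by simpa using h)]

/-- The inverse transform preserves the length. [folklore] -/
theorem length_inv (inv2 : S) : ∀ (F lv : ℕ) {M : List S}, M.length = 2 ^ lv → (inv ψ m inv2 F lv M).length = 2 ^ lv
  | F, 0, M, hM => hM
  | F, lv + 1, M, hM => by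
    have h1 : (M.take (M.length / 2)).length = 2 ^ lv := by rw [List.length_take, hM, pow_succ]; omega
    have h2 : (M.drop (M.length / 2)).length = 2 ^ lv := by rw [List.length_drop, hM, pow_succ]; omega
    have i1 := length_inv inv2 (F / 2) lv h1
    have i2 := length_inv inv2 (F / 2 + 2 * m) lv h2
    rw [inv, ibfly]
    simp only [List.length_append, List.length_zipWith, List.length_take, List.length_drop, i1, i2]
    rw [pow_succ]; omega

/-- **The inverse butterfly inverts the butterfly** (`2 · inv2 = 1`, `ψ^{4m} = 1`, `E ≤ 4m`).
[folklore] -/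
theorem ibfly_bfly_halves (inv2 : S) (h2 : inv2 * 2 = 1) (hψ4 : ψ ^ (4 * m) = 1) {E : ℕ} (hE : E ≤ 4 * m)
    {U W : List S} (hUW : U.length = W.length) :
    ibfly ψ m inv2 E (List.zipWith (fun u w => u + ψ ^ E * w) U W ++ List.zipWith (fun u w => u - ψ ^ E * w) U W) =
      U ++ W := by
  set L1 := List.zipWith (fun u w => u + ψ ^ E * w) U W with hL1
  set L2 := List.zipWith (fun u w => u - ψ ^ E * w) U W with hL2
  have hl1 : L1.length = U.length := by rw [hL1, List.length_zipWith, hUW, min_self]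
  have hl2 : L2.length = U.length := by rw [hL2, List.length_zipWith, hUW, min_self]
  have hh : (L1 ++ L2).length / 2 = L1.length := by rw [List.length_append, hl1, hl2]; omega
  have htk : (L1 ++ L2).take ((L1 ++ L2).length / 2) = L1 := by rw [hh, List.take_append_of_le_length le_rfl, List.take_length]
  have hdr : (L1 ++ L2).drop ((L1 ++ L2).length / 2) = L2 := by rw [hh, List.drop_append_of_le_length le_rfl, List.drop_length, List.nil_append]
  have hcancel : ψ ^ (4 * m - E) * ψ ^ E = 1 := by rw [← pow_add, Nat.sub_add_cancel hE, hψ4]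
  unfold ibfly
  rw [htk, hdr, hL1, hL2, zipWith_zipWith_same, zipWith_zipWith_same]
  congr 1
  · conv_rhs => rw [← zipWith_fst U W hUW]
    refine congrArg (fun f => List.zipWith f U W) (funext fun u => funext fun w => ?_)
    linear_combination u * h2
  · conv_rhs => rw [← zipWith_snd U W hUW]
    refine congrArg (fun f => List.zipWith f U W) (funext fun u => funext fun w => ?_)
    linear_combination (ψ ^ E * w) * h2 * (ψ ^ (4 * m - E)) + w * hcancel

/-- **Inversion**: `inv F lv (fwd F lv L) = L` for `|L| = 2^lv`, `F < 4m`, `2 · inv2 = 1`,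
`ψ^{4m} = 1`. [von zur Gathen–Gerhard 2013, Thm. 8.22 (correctness of Alg. 8.20)] [folklore] -/
theorem inv_fwd (inv2 : S) (h2 : inv2 * 2 = 1) (hψ4 : ψ ^ (4 * m) = 1) :
    ∀ {F lv : ℕ} {L : List S}, F < 4 * m → L.length = 2 ^ lv → inv ψ m inv2 F lv (fwd ψ m F lv L) = L
  | F, 0, L, _, _ => rfl
  | F, lv + 1, L, hF, hL => by
    have hL2 : L.length = 2 * 2 ^ lv := by rw [hL, pow_succ]; ring
    obtain ⟨h1, h2', e1, e2⟩ := length_bfly_take (ψ := ψ) (F / 2) (h := 2 ^ lv) (L := L) hL2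
    have hf1 := length_fwd (ψ := ψ) (m := m) (F / 2) lv h1
    have hf2 := length_fwd (ψ := ψ) (m := m) (F / 2 + 2 * m) lv h2'
    have htot : (fwd ψ m F (lv + 1) L).length / 2 = 2 ^ lv := by
      rw [fwd, List.length_append, hf1, hf2]; omega
    rw [inv]
    rw [htot, fwd, List.take_append_of_le_length (by rw [hf1]), List.take_of_length_le (by rw [hf1]),
      List.drop_append_of_le_length (by rw [hf1]), List.drop_of_length_le (by rw [hf1]), List.nil_append,
      inv_fwd inv2 h2 hψ4 (by omega) h1, inv_fwd inv2 h2 hψ4 (by omega) h2', e1, e2,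
      ibfly_bfly_halves inv2 h2 hψ4 (by omega) (by rw [List.length_take, List.length_drop, hL2]; omega),
      List.take_append_drop]

/-! ### The product theorem -/

omit [CommRing S] in
/-- Zipping two maps of the same list. [folklore] -/
theorem zipWith_map_map {α : Type*} (f g : α → S) (h : S → S → S) (l : List α) :
    List.zipWith h (l.map f) (l.map g) = l.map fun x => h (f x) (g x) := by
  induction l with
  | nil => rfl
  | cons a l ih => simp [ih]

/-- **The negacyclic FFT multiplies**: for lists `A`, `B` of length `2^lv` below a node `(F, lv)`
(`ψ^{2m} = -1`, `2^lv ∣ F`, `2^lv ∣ 4m`, `F < 4m`, `2 · inv2 = 1`), transforming both, multiplying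
pointwise and transforming back yields the twisted convolution in `S[y]/(y^{2^lv} - ψ^F)`; at the
root (`F = 2m`, `ψ^F = -1`) this is the negacyclic product. [von zur Gathen–Gerhard 2013,
Thm. 8.22–8.23; Cantor–Kaltofen 1991, Thm. 2.x] [folklore] -/
theorem inv_mul_fwd (hψ : ψ ^ (2 * m) = -1) (inv2 : S) (h2 : inv2 * 2 = 1) {F lv : ℕ} (hF : 2 ^ lv ∣ F)
    (hm : 2 ^ lv ∣ 4 * m) (hF4 : F < 4 * m) {A B : List S} (hA : A.length = 2 ^ lv) (hB : B.length = 2 ^ lv) :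
    inv ψ m inv2 F lv (List.zipWith (· * ·) (fwd ψ m F lv A) (fwd ψ m F lv B)) = tconv (ψ ^ F) (2 ^ lv) A B := by
  have hψ4 : ψ ^ (4 * m) = 1 := by rw [show 4 * m = 2 * m + 2 * m by ring, pow_add, hψ]; norm_num
  have hprod : List.zipWith (· * ·) (fwd ψ m F lv A) (fwd ψ m F lv B) = fwd ψ m F lv (tconv (ψ ^ F) (2 ^ lv) A B) := by
    rw [fwd_eq_map_ev hψ hF hm hA, fwd_eq_map_ev hψ hF hm hB, fwd_eq_map_ev hψ hF hm (length_tconv _ _ _ _),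
      zipWith_map_map]
    refine List.map_congr_left fun G hG => ?_
    exact (ev_tconv (ψ ^ G) (ψ ^ F) (pow_leafExps hψ hF hm G hG) hA hB).symm
  rw [hprod, inv_fwd inv2 h2 hψ4 hF4 (length_tconv _ _ _ _)]

/-- The entries of the twisted convolution at the root, where `ψ^F = -1`: the negacyclic digit
`C_σ = Σ_{i+l=σ} A_i B_l - Σ_{i+l=σ+t} A_i B_l`. [folklore] -/
theorem getD_tconv_neg_one (t : ℕ) (A B : List S) {σ : ℕ} (hσ : σ < t) :
    (tconv (-1) t A B).getD σ 0 =
      ∑ i ∈ range t, ∑ l ∈ range t, (if i + l = σ then A.getD i 0 * B.getD l 0 else 0) -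
        ∑ i ∈ range t, ∑ l ∈ range t, (if i + l = σ + t then A.getD i 0 * B.getD l 0 else 0) := by
  rw [getD_tconv _ _ _ _ hσ, sub_eq_add_neg, ← Finset.sum_neg_distrib, ← Finset.sum_add_distrib]
  refine Finset.sum_congr rfl fun i _ => ?_
  rw [← Finset.sum_neg_distrib, ← Finset.sum_add_distrib]
  refine Finset.sum_congr rfl fun l _ => ?_
  split_ifs <;> ring

end NegFFT



end Literature.Computability.Complexity
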